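import Literature.NumberTheory.DiophantineGeometry.GenEllDeBadPrimes
import Literature.NumberTheory.DiophantineGeometry.GenEllDeCriticalLocusReduction
import Literature.NumberTheory.DiophantineGeometry.GenEllRamificationLocus
import HarnessLib

/-!
# [GenEll] Thm. 2.1 on the `D_e` route: the converse `hconv` off the bad primes, and the grand junction

S. Mochizuki, *Arithmetic elliptic curves in general position*, Math. J. Okayama Univ. **52** (2010),
Prop. 1.6 p. 10 / proof of Thm. 2.1 pp. 12–13 [cite: MochizukiGenEll2010, Thm 2.1 proof p.13]; support
file for the route item `GenEllTwo` (stmt-ABC-19679), abc-iut-S6 `GENELLTWO-P1ROUTE.md` §3 (d), W5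
closure map of abc-iut-w5-d045 (row `hmeet / hoff`, input `hconv`).

The sharp good-place inequality (`De.hmeet_hoff_off_badPrimes`, this seat) takes as its one remaining
W5-external input the CONVERSE `hconv : w(N(P)) < 1 → ∃ b ∈ B, w(t(P) − b) < 1` — "a good prime dividing
the ramification function at `P` is a prime at which `t(P)` meets `B`".  abc-iut-w5-d071's
`DeCrit.exists_critValue_near` proves, at a place `w` with `w(2) = w(e) = 1` of a field in which the
critical polynomial `R = α² − β³` splits, that a `w`-integral point `P` with `w(N(P)) < 1` is
`w`-adically close to a ramification point `Q_θ` and `w(t(P) − t(Q_θ)) < 1`; abc-iut-w5-d059's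
`RamLocus.one_lt_valuation_N_of_r_gt` shows that off the integral chart (`w(r) > 1`) one has `w(N) > 1`.
This file packages the two into the `hconv` shape, uniformly in the test field:

* `De.hconv_off_badPrimes` — for `B ⊂ K` containing the critical values `t(Q_θ)` (`θ` the roots of `R`,
  all in `K`): for every number field `L ⊇ K`, every finite `T ⊇ primeFactors (2·(2k+1))` and every
  finite place `w` of `L` not over `T`, every point datum `(r, s, t, N)` in the `D_e` normal forms with
  `w(N) < 1` has `w(t − b) < 1` for some `b ∈ B` (mapped to `L`);
* `De.hmeet_hoff_of_critValues` — the GRAND JUNCTION: `hmeet`/`hoff` of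
  `FibreConductor.inv_finrank_mul_sum_logNorm_le_slope` (abc-iut-w5-d009) off `⋃_{p∈T} placesOver L p`
  for every `T ⊇ S(e, B)`, from ONLY: `R` splits in `K`, the critical values lie in `B`, the normal
  forms of the point, `N ≠ 0`, `t ∉ B`, and the definition of the meeting set `W`.

Theorems only; classical; nothing here bears on [IUTchIII] Cor. 3.12.
-/

noncomputable section

namespace Literature.NumberTheory.DiophantineGeometry.GenEll

open _root_.Polynomial NumberField IsDedekindDomain
open Literature.IUT.LogVolume

universe u

section Generic

variable {K : Type u} [Field K]

/-- The normal forms force `r ≠ 0` and `s ≠ 0` (the point is not a pole of `t`).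
[cite: MochizukiGenEll2010, Thm 2.1 proof p.13] -/
theorem De.r_ne_zero_and_s_ne_zero {L : Type*} [Field L] (k : ℕ) {r s t : L}
    (hcurve : s ^ 2 = 1 - 4 * r ^ (2 * k + 1)) (ht : t * (r * s) = s + r ^ (k + 2)) :
    r ≠ 0 ∧ s ≠ 0 := by
  have hr : r ≠ 0 := by
    rintro rfl
    have hs : s ^ 2 = 1 := by rw [hcurve]; simp
    have hs0 : s = 0 := by
      have h := ht
      rw [zero_mul, mul_zero, zero_pow (by omega : k + 2 ≠ 0), add_zero] at h
      exact h.symm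
    rw [hs0] at hs; norm_num at hs
  refine ⟨hr, ?_⟩
  rintro rfl
  have h := ht
  rw [mul_zero, mul_zero, zero_add] at h
  exact hr ((pow_eq_zero_iff (by omega : k + 2 ≠ 0)).mp h.symm)

/-- A root of `R` in `L ⊇ K` comes from a root in `K` when `R` splits in `K`.
[cite: MochizukiGenEll2010, Thm 2.1 proof p.13] -/
theorem De.exists_root_eq_algebraMap (k : ℕ) {L : Type*} [Field L] [Algebra K L]
    (hsplit : ((DeCrit.Rpoly k).map (algebraMap ℤ K)).Splits) {θ : L}
    (hθ : aeval θ (DeCrit.Rpoly k) = 0) :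
    ∃ θ₀ : K, aeval θ₀ (DeCrit.Rpoly k) = 0 ∧ algebraMap K L θ₀ = θ := by
  have hmap : (DeCrit.Rpoly k).map (algebraMap ℤ L) =
      ((DeCrit.Rpoly k).map (algebraMap ℤ K)).map (algebraMap K L) := by
    rw [Polynomial.map_map, RingHom.ext_int ((algebraMap K L).comp (algebraMap ℤ K)) (algebraMap ℤ L)]
  have hmem : θ ∈ ((DeCrit.Rpoly k).map (algebraMap ℤ L)).roots := by
    rw [mem_roots (DeCrit.Rpoly_map_ne_zero k), IsRoot.def, eval_map, ← aeval_def]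
    exact hθ
  rw [hmap, hsplit.roots_map (algebraMap K L), Multiset.mem_map] at hmem
  obtain ⟨θ₀, hθ₀, rfl⟩ := hmem
  refine ⟨θ₀, ?_, rfl⟩
  rw [mem_roots (DeCrit.Rpoly_map_ne_zero k), IsRoot.def, eval_map, ← aeval_def] at hθ₀
  exact hθ₀

/-- The critical value `t(Q_θ)` is functorial in the field. [cite: MochizukiGenEll2010, Thm 2.1 proof p.13] -/
theorem De.algebraMap_critValue (k : ℕ) {L : Type*} [Field L] [Algebra K L] (θ : K) :
    algebraMap K L (((1 - 2 * DeCrit.critX k θ) + θ ^ (k + 2)) / (θ * (1 - 2 * DeCrit.critX k θ))) =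
      ((1 - 2 * DeCrit.critX k (algebraMap K L θ)) + (algebraMap K L θ) ^ (k + 2)) /
        (algebraMap K L θ * (1 - 2 * DeCrit.critX k (algebraMap K L θ))) := by
  rw [← DeCrit.map_critX (algebraMap K L) k θ]
  simp [map_div₀, map_sub, map_add, map_mul, map_pow, map_ofNat]

end Generic

section Converse

variable {K : Type u} [Field K] [NumberField K]

omit [NumberField K] in
open scoped Classical in
/-- **The converse `hconv` off the bad primes.** Let `B ⊂ K` contain the critical values `t(Q_θ)` of
`t` on `D_e`, `θ` ranging over the roots of `R = α² − β³`, all of which lie in `K` (`R` splits in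
`K`).  Then for every number field `L ⊇ K`, every finite set `T` of primes containing the prime
factors of `2·(2k+1)`, every finite place `w` of `L` not over `T`, and every point datum
`(r, s, t, N)` in the normal forms of the `D_e` route: `w(N) < 1 ⇒ ∃ b ∈ B, w(t − b) < 1`.
(Integral chart: abc-iut-w5-d071's `DeCrit.exists_critValue_near`; off it `w(N) > 1` by
abc-iut-w5-d059's `RamLocus.one_lt_valuation_N_of_r_gt`.) [cite: MochizukiGenEll2010, Thm 2.1 proof p.13] -/
theorem De.hconv_off_badPrimes (k : ℕ) (B : Finset K)
    (hsplit : ((DeCrit.Rpoly k).map (algebraMap ℤ K)).Splits)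
    (hcritB : ∀ θ : K, aeval θ (DeCrit.Rpoly k) = 0 →
      ((1 - 2 * DeCrit.critX k θ) + θ ^ (k + 2)) / (θ * (1 - 2 * DeCrit.critX k θ)) ∈ B)
    (L : Type u) [Field L] [NumberField L] [Algebra K L] (T : Finset ℕ)
    (hT : (2 * (2 * k + 1)).primeFactors ⊆ T) (w : HeightOneSpectrum (𝓞 L))
    (hw : w ∉ T.attach.biUnion (fun p => placesOver L p.1)) {r s t N : L}
    (hcurve : s ^ 2 = 1 - 4 * r ^ (2 * k + 1)) (ht : t * (r * s) = s + r ^ (k + 2))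
    (hN : N = -s ^ 3 + (k + 1) * r ^ (k + 2) - 2 * r ^ (3 * k + 3))
    (hNlt : w.valuation L N < 1) :
    ∃ b ∈ B.map ⟨algebraMap K L, (algebraMap K L).injective⟩, w.valuation L (t - b) < 1 := by
  classical
  -- the place is good: `w(2) = w(2k+1) = 1`
  have hD0 : 2 * (2 * k + 1) ≠ 0 := by positivity
  have hwD : w ∉ (2 * (2 * k + 1)).primeFactors.attach.biUnion (fun p => placesOver L p.1) := by
    intro hmem
    obtain ⟨p, -, hp⟩ := Finset.mem_biUnion.mp hmem
    exact hw (Finset.mem_biUnion.mpr ⟨⟨p.1, hT p.2⟩, Finset.mem_attach _ _, hp⟩)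
  have hval : w.valuation L ((2 * (2 * k + 1) : ℕ) : L) = 1 :=
    valuation_natCast_eq_one_of_not_mem_biUnion w hD0 hwD
  have h2 : w.valuation L (2 : L) = 1 := by
    have h := valuation_natCast_eq_one_of_dvd w (⟨2 * k + 1, rfl⟩ : 2 ∣ 2 * (2 * k + 1)) hval
    simpa using h
  have he : w.valuation L ((2 * k + 1 : ℕ) : L) = 1 :=
    valuation_natCast_eq_one_of_dvd w (⟨2, by ring⟩ : (2 * k + 1) ∣ 2 * (2 * k + 1)) hval
  have h2L : (2 : L) ≠ 0 := two_ne_zero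
  obtain ⟨hr0, hs0⟩ := De.r_ne_zero_and_s_ne_zero k hcurve ht
  -- the `N` of the normal form is d071's `Nval` at `x := (1 - s)/2`, and d059's expression
  set x : L := (1 - s) / 2 with hxdef
  have hx : 1 - 2 * x = s := by rw [hxdef]; field_simp; ring
  have hcx : r ^ (2 * k + 1) = x * (1 - x) := by
    have e : x * (1 - x) = (1 - s ^ 2) / 4 := by rw [hxdef]; field_simp; ring
    rw [e, hcurve]; ring
  have hNval : DeCrit.Nval k (x, r) = N := by
    rw [hN, DeCrit.Nval, DeCrit.alpha, hx]
    push_cast; ring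
  have hN059 : N = -s ^ 3 + ((k : L) + 1) * r ^ (k + 2) - 2 * r ^ (3 * k + 3) := by
    rw [hN]
  have htdiv : t = (s + r ^ (k + 2)) / (r * s) := by
    rw [eq_div_iff (mul_ne_zero hr0 hs0)]; exact ht
  -- off the integral chart `N` is large
  by_cases hr : w.valuation L r ≤ 1
  swap
  · exfalso
    have hgt := RamLocus.one_lt_valuation_N_of_r_gt (k := k) (w.valuation L) hcurve h2 (not_le.mp hr)
    rw [← hN059] at hgt
    exact (lt_irrefl _) (hgt.trans hNlt)
  -- in the chart: d071
  have hsplitL : ((DeCrit.Rpoly k).map (algebraMap ℤ L)).Splits := by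
    have hmap : (DeCrit.Rpoly k).map (algebraMap ℤ L) =
        ((DeCrit.Rpoly k).map (algebraMap ℤ K)).map (algebraMap K L) := by
      rw [Polynomial.map_map,
        RingHom.ext_int ((algebraMap K L).comp (algebraMap ℤ K)) (algebraMap ℤ L)]
    rw [hmap]; exact hsplit.map _
  have hNlt' : w.valuation L (DeCrit.Nval k (x, r)) < 1 := by rw [hNval]; exact hNlt
  obtain ⟨θ, hθR, -, -, hclose⟩ :=
    DeCrit.exists_critValue_near (w.valuation L) k h2 he hsplitL hcx hr hNlt'
  obtain ⟨θ₀, hθ₀, rfl⟩ := De.exists_root_eq_algebraMap k hsplit hθR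
  refine ⟨algebraMap K L (((1 - 2 * DeCrit.critX k θ₀) + θ₀ ^ (k + 2)) /
      (θ₀ * (1 - 2 * DeCrit.critX k θ₀))),
    Finset.mem_map.mpr ⟨_, hcritB θ₀ hθ₀, rfl⟩, ?_⟩
  rw [De.algebraMap_critValue, htdiv, ← hx]
  exact hclose

open scoped Classical in
/-- **GRAND JUNCTION: `hmeet`/`hoff` from the critical values alone.** For `k` (`e = 2k+1`) and a
finite `B ⊂ K` containing the critical values of `t` (`R` split in `K`), there is a finite set
`S ∋ 2` of primes such that for every number field `L ⊇ K`, every finite `T ⊇ S`, every point datum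
`(r, s, t, N)` in the normal forms with `N ≠ 0` and `t ∉ B`, and every finite `W` which off
`Sbad := ⋃_{p∈T} placesOver L p` is the meeting set `{w | ∃ b ∈ B, 0 < ord_w (t − b)}`:
on `W ∖ Sbad`, `1 + ord⁺_w N ≤ Σ_{b∈B} ord⁺_w (t − b)`, and off `W ∪ Sbad`,
`ord⁺_w N ≤ Σ_{b∈B} ord⁺_w (t − b)` — the hypotheses `hmeet`/`hoff` of
`FibreConductor.inv_finrank_mul_sum_logNorm_le_slope`, with NO residual local hypothesis.
[cite: MochizukiGenEll2010, Thm 2.1 proof p.13] -/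
theorem De.hmeet_hoff_of_critValues (k : ℕ) (B : Finset K)
    (hsplit : ((DeCrit.Rpoly k).map (algebraMap ℤ K)).Splits)
    (hcritB : ∀ θ : K, aeval θ (DeCrit.Rpoly k) = 0 →
      ((1 - 2 * DeCrit.critX k θ) + θ ^ (k + 2)) / (θ * (1 - 2 * DeCrit.critX k θ)) ∈ B) :
    ∃ S : Finset ℕ, 2 ∈ S ∧ (∀ p ∈ S, p.Prime) ∧
      ∀ (L : Type u) [Field L] [NumberField L] [Algebra K L] (T : Finset ℕ), S ⊆ T →
        ∀ {r s t N : L},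
        s ^ 2 = 1 - 4 * r ^ (2 * k + 1) → t * (r * s) = s + r ^ (k + 2) →
        N = -s ^ 3 + (k + 1) * r ^ (k + 2) - 2 * r ^ (3 * k + 3) → N ≠ 0 →
        (∀ b ∈ B, t ≠ algebraMap K L b) →
        ∀ W : Finset (HeightOneSpectrum (𝓞 L)),
        (∀ w : HeightOneSpectrum (𝓞 L), w ∉ T.attach.biUnion (fun p => placesOver L p.1) →
          (w ∈ W ↔ ∃ b ∈ B.map ⟨algebraMap K L, (algebraMap K L).injective⟩, 0 < ord L w (t - b))) →
        (∀ w ∈ W, w ∉ T.attach.biUnion (fun p => placesOver L p.1) →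
            1 + (ord L w N).toNat ≤
              ∑ b ∈ B.map ⟨algebraMap K L, (algebraMap K L).injective⟩, (ord L w (t - b)).toNat) ∧
        (∀ w, w ∉ W → w ∉ T.attach.biUnion (fun p => placesOver L p.1) →
            (ord L w N).toNat ≤
              ∑ b ∈ B.map ⟨algebraMap K L, (algebraMap K L).injective⟩, (ord L w (t - b)).toNat) := by
  classical
  obtain ⟨S₀, h2S₀, hS₀p, hS₀⟩ := De.hmeet_hoff_off_badPrimes_of_subset (K := K) k B
  refine ⟨S₀ ∪ (2 * (2 * k + 1)).primeFactors, Finset.mem_union_left _ h2S₀, ?_, ?_⟩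
  · intro p hp
    rcases Finset.mem_union.mp hp with h | h
    · exact hS₀p p h
    · exact Nat.prime_of_mem_primeFactors h
  intro L _ _ _ T hST r s t N hcurve ht hN hN0 htB W hW
  have hS₀T : S₀ ⊆ T := fun p hp => hST (Finset.mem_union_left _ hp)
  have hPT : (2 * (2 * k + 1)).primeFactors ⊆ T := fun p hp => hST (Finset.mem_union_right _ hp)
  exact hS₀ L T hS₀T hcurve ht hN hN0 htB W
    (fun w hw hNlt => De.hconv_off_badPrimes k B hsplit hcritB L T hPT w hw hcurve ht hN hNlt) hW

end Converse

end Literature.NumberTheory.DiophantineGeometry.GenEll
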